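import Mathlib
import HarnessLib
import Summits.AtomisticToContinuum.Statement
import Summits.AtomisticToContinuum.Crystallization.Theses.OverbindingBudget
import Summits.AtomisticToContinuum.Crystallization.Theorems.OverbindingBudgetRecurrenceDividend
import Summits.AtomisticToContinuum.Crystallization.Theorems.OverbindingBudgetBindingSignLaw
import Summits.AtomisticToContinuum.Crystallization.Theorems.OverbindingBudgetExcessInstability

/-!
# OverbindingBudget — violator density floor and the sticky-sphere rung (BC5 witness material)

Route `OverbindingBudget`, residual `RobustDefectLimitWindows` (stmt-AtomisticToContinuum-31280).  Two TRUE laws of the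
decomp-a2c lens-4 lineage (gen 9 node «ClusterSurgeryCatalogue», §4–§5, kernel-checked there; landed verbatim here as support
theorems for the item, so that the route tribunal can cite `stickyZeroSlackRung` as its BC5 witness):

* `violatorDensityFloor` — in the residual world (uniformly discrete, two-way uniformly recurrent, relatively dense, gapped-twelve
  clean at no scale `a ∈ [47/50, 1]`) the margin-`t` violators of the landed `recurrenceDividend` (stmt-31267) have POSITIVE CUBE
  DENSITY: every half-open cube of side `n·s` holds at least `n³` of them, at every scale simultaneously (dividend × the landed
  `grid_lower_bound`).
* `stickyZeroSlackRung` — the sticky-sphere analogue in which the whole residual collapses: a hard-core-1, relatively dense, two-way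
  recurrent set whose ℕ-truncated `τ/2`-contact deficit `12 − #Kiss` has zero cube density has NO `τ`-contact-deficient site
  (recurrence dividend for contact counts × grid lower bound × zero-mean law; integer charges leave no slack).  For Lennard-Jones the
  overbinding capacity is positive (≤ 1/8 per site), which is the difficulty of the residual.

Deps (tree only): `Theses.OverbindingBudget`, `Theorems.OverbindingBudgetRecurrenceDividend` (`recurrenceDividend`, `finite_shell`,
`abs_dist_sub_dist_le`), `Theorems.OverbindingBudgetBindingSignLaw` (`grid_lower_bound`), `Theorems.OverbindingBudgetExcessInstability`
(`finite_inter_cube`).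
-/

namespace Summit.AtomisticToContinuum.Crystallization.Theorems.OverbindingBudgetViolatorDensityFloor

open scoped BigOperators Topology
open Filter Set
open Literature.MathematicalPhysics.StatisticalMechanics (UniformlyDiscrete)
open Summit.AtomisticToContinuum.Crystallization.Theses.OverbindingBudget
open Summit.AtomisticToContinuum.Crystallization.Theorems.OverbindingBudgetRecurrenceDividend
  (recurrenceDividend finite_shell abs_dist_sub_dist_le)
open Summit.AtomisticToContinuum.Crystallization.Theorems.OverbindingBudgetBindingSignLaw (grid_lower_bound)
open Summit.AtomisticToContinuum.Crystallization.Theorems.OverbindingBudgetExcessInstability (finite_inter_cube)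

/-! ## §1 Readable predicates (verbatim the lineage's clauses) -/

/-- `GT a Y p`: the site `p` passes the EXACT gapped-twelve test at spacing `a` in `Y` (verbatim the lineage's clause). -/
def GT (a : ℝ) (Y : Set (EuclideanSpace ℝ (Fin 3))) (p : EuclideanSpace ℝ (Fin 3)) : Prop :=
  ({w ∈ Y | w ≠ p ∧ dist p w ≤ a * (1 + 1 / 50)}.ncard = 12 ∧ ∀ w ∈ Y, w ≠ p → a * (1 - 1 / 50) ≤ dist p w ∧ (dist p w ≤ a * (1 + 1 / 50) ∨ a * (63 / 50) ≤ dist p w))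

/-- `RT a t Y y`: the site `y` passes the `t`-RELAXED gapped-twelve test at spacing `a` (verbatim the clause of ROBUST /
`RecurrenceDividend`, stmt-31267). -/
def RT (a t : ℝ) (Y : Set (EuclideanSpace ℝ (Fin 3))) (y : EuclideanSpace ℝ (Fin 3)) : Prop :=
  ({w ∈ Y | w ≠ y ∧ dist y w < a * (63 / 50) - t}.ncard ≤ 12 ∧ 12 ≤ {w ∈ Y | w ≠ y ∧ dist y w ≤ a * (1 + 1 / 50) + t}.ncard ∧ ∀ w ∈ Y, w ≠ y → a * (1 - 1 / 50) - t ≤ dist y w ∧ (dist y w ≤ a * (1 + 1 / 50) + t ∨ a * (63 / 50) - t ≤ dist y w))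

/-! ## §4 TRUE law, proved: robust violators have positive cube density (the quantitative content of ROBUST)

Any pricing / surgery door is multiplied against THIS density: in W (recurrent, uniformly discrete, relatively dense, gapped-twelve clean at
no scale) the landed dividend `recurrenceDividend` (stmt-31267) puts a margin-`t` violator in every `L`-ball around every site, for every
scale of the window; with the covering radius `< 9/10` and the landed grid lemma `grid_lower_bound` this is a DENSITY FLOOR: every half-open
cube of side `n·s`, `s = 2·max(L,0) + 2`, contains at least `n³` margin-`t` violators, at every scale `a ∈ [47/50, 1]` simultaneously. -/

/-- **Violator density floor.** [folklore; this file — from the landed `recurrenceDividend` + `grid_lower_bound`] -/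
theorem violatorDensityFloor {Y : Set (EuclideanSpace ℝ (Fin 3))} (hUD : UniformlyDiscrete Y)
    (hrec : (∀ R ε : ℝ, 0 < ε → ∃ L : ℝ, ∀ p ∈ Y, ∀ q ∈ Y, ∃ q' ∈ Y, dist q' q ≤ L ∧ (∀ y ∈ Y, dist y p ≤ R → ∃ y' ∈ Y, dist (y' - q') (y - p) ≤ ε) ∧ (∀ y' ∈ Y, dist y' q' ≤ R → ∃ y ∈ Y, dist (y' - q') (y - p) ≤ ε)))
    (hgap : ¬ (∃ a : ℝ, 47 / 50 ≤ a ∧ a ≤ 1 ∧ ∀ y ∈ Y, GT a Y y))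
    (hcov : ∀ z : EuclideanSpace ℝ (Fin 3), ∃ w ∈ Y, dist z w < 9 / 10) :
    ∃ s t : ℝ, 0 < s ∧ 0 < t ∧ ∀ a : ℝ, 47 / 50 ≤ a → a ≤ 1 →
      ∀ (n : ℕ) (c : EuclideanSpace ℝ (Fin 3)) (F : Finset (EuclideanSpace ℝ (Fin 3))),
        (↑F : Set (EuclideanSpace ℝ (Fin 3))) = Y ∩ {z | ∀ i : Fin 3, c i ≤ z i ∧ z i < c i + n * s} →
        (n : ℝ) ^ 3 ≤ (({y ∈ (↑F : Set (EuclideanSpace ℝ (Fin 3))) | ¬ RT a t Y y}.ncard : ℕ) : ℝ) := by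
  classical
  obtain ⟨L, t, ht, hr⟩ := recurrenceDividend Y hUD hrec hgap
  set L' : ℝ := max L 0 with hL'
  set s : ℝ := 2 * L' + 2 with hs
  have hL'0 : 0 ≤ L' := le_max_right L 0
  have hs0 : 0 < s := by rw [hs]; linarith
  refine ⟨s, t, hs0, ht, fun a ha1 ha2 n c F hF => ?_⟩
  have hg : ∀ y ∈ Y, (0 : ℝ) ≤ (fun y => if RT a t Y y then (0 : ℝ) else 1) y := by
    intro y _
    simp only
    split_ifs <;> norm_num
  have hheavy : ∀ z : EuclideanSpace ℝ (Fin 3), ∃ q ∈ Y, dist q z < s / 2 ∧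
      (1 : ℝ) ≤ (fun y => if RT a t Y y then (0 : ℝ) else 1) q := by
    intro z
    obtain ⟨w, hw, hzw⟩ := hcov z
    obtain ⟨y, hy, hyw, hviol⟩ := hr w hw a ha1 ha2
    refine ⟨y, hy, ?_, ?_⟩
    · calc dist y z ≤ dist y w + dist w z := dist_triangle _ _ _
        _ < s / 2 := by rw [dist_comm w z, hs]; linarith [le_max_left L 0]
    · have hv : ¬ RT a t Y y := hviol
      simp only [if_neg hv, le_refl]
  have h1 : (n : ℝ) ^ 3 * 1 ≤ ∑ y ∈ F, (fun y => if RT a t Y y then (0 : ℝ) else 1) y :=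
    grid_lower_bound _ hg hs0 hheavy n c F hF
  have h2 : ∑ y ∈ F, (fun y => if RT a t Y y then (0 : ℝ) else 1) y
      = (((F.filter (fun y => ¬ RT a t Y y)).card : ℕ) : ℝ) := by
    rw [Finset.card_filter]
    push_cast
    refine Finset.sum_congr rfl (fun y _ => ?_)
    by_cases h : RT a t Y y <;> simp [h]
  have h3 : {y ∈ (↑F : Set (EuclideanSpace ℝ (Fin 3))) | ¬ RT a t Y y}.ncard = (F.filter (fun y => ¬ RT a t Y y)).card := by
    rw [← Set.ncard_coe_finset (F.filter (fun y => ¬ RT a t Y y))]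
    congr 1
    ext y
    simp
  rw [h3, ← h2]
  linarith

/-! ## §5 TRUE law, proved: the STICKY-SPHERE RUNG (toy analogue in which the whole residual collapses)

BC5-type witness for the lineage's deciding residual (RDEF 31280 / THIN 30250; tribunal kernel `t3:absent` on the route): replace the
Lennard-Jones site charge `φ_Y − 2e` by the sticky-sphere charge `12 − #(τ-contacts)` (hard core 1, contact = distance ≤ 1 + τ).  This charge is
a NONNEGATIVE INTEGER (kissing), so the zero-mean cube law of W (Σ_cube charge = o(ℓ³), the analogue of the landed `cubeChargeLaw`) together
with recurrence and relative density forces EVERY site to be 12-kissing: the defected recurrent zero-mean world is EMPTY in the sticky model —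
by exactly the lever of this lineage (recurrence dividend × cube budget), with OVERBINDING CAPACITY ZERO.  For Lennard-Jones the capacity
is positive (≤ 1/8 per site, `OverbindingCap`), which is the whole difficulty of the residual; and the sticky conclusion «all sites 12-kissing»
is where Hales' Fejes Tóth theorem (arXiv:1209.6043: 12-kissing packings are Barlow) takes over, while periodic WINDOWS for sticky-sphere
ground states are NOT known (stacking degeneracy) — so the rung lies outside S's known regime.  Stated with the ℕ-truncated deficit
`12 − #contacts` (so no kissing-number theorem is needed as input) and the lineage's own recurrence / covering / cube clauses. -/

/-- `Kiss τ Y y`: the punctured `τ`-contact shell of `y` in `Y` (sticky spheres of diameter 1: contacts at distance ≤ 1 + τ). -/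
def Kiss (τ : ℝ) (Y : Set (EuclideanSpace ℝ (Fin 3))) (y : EuclideanSpace ℝ (Fin 3)) : Set (EuclideanSpace ℝ (Fin 3)) :=
  {w ∈ Y | w ≠ y ∧ dist y w ≤ 1 + τ}

/-- **Contact transfer.**  Along a backward `τ/4`-matching of `(1+τ)`-patches (the lineage's recurrence clause) the `τ/2`-contact shell of the
copy `q'` injects into the `τ`-contact shell of the original `p` (hard core ⇒ matched points distinct, off-centre, injective). [folklore] -/
theorem kiss_transfer {Y : Set (EuclideanSpace ℝ (Fin 3))} {τ : ℝ} (hτ : 0 < τ) (hτ1 : τ ≤ 1)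
    (hcore : ∀ p ∈ Y, ∀ q ∈ Y, p ≠ q → 1 ≤ dist p q)
    {p q' : EuclideanSpace ℝ (Fin 3)} (_hp : p ∈ Y) (hq' : q' ∈ Y)
    (hbwd : ∀ y' ∈ Y, dist y' q' ≤ 1 + τ → ∃ y ∈ Y, dist (y' - q') (y - p) ≤ τ / 4) :
    (Kiss (τ / 2) Y q').ncard ≤ (Kiss τ Y p).ncard := by
  have hUD : UniformlyDiscrete Y := ⟨1, one_pos, hcore⟩
  choose! ψ hψY hψd using hbwd
  have hψdist : ∀ y' ∈ Y, dist y' q' ≤ 1 + τ → |dist q' y' - dist p (ψ y')| ≤ τ / 4 :=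
    fun y' hy' hyR => abs_dist_sub_dist_le (hψd y' hy' hyR)
  refine Set.ncard_le_ncard_of_injOn ψ (fun w' hw' => ?_) (fun w₁ hw₁ w₂ hw₂ hEq => ?_) (finite_shell hUD p _)
  · obtain ⟨hwY, hwq, hwd⟩ := hw'
    have hwR : dist w' q' ≤ 1 + τ := by rw [dist_comm]; linarith
    have hd := abs_le.1 (hψdist w' hwY hwR)
    refine ⟨hψY w' hwY hwR, ?_, ?_⟩
    · intro hEq
      have h1 := hcore w' hwY q' hq' hwq
      rw [hEq, dist_self] at hd
      rw [dist_comm] at h1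
      linarith [hd.1, hd.2]
    · linarith [hd.1, hd.2]
  · by_contra hne
    have h1 := hcore w₁ hw₁.1 w₂ hw₂.1 hne
    have hR₁ : dist w₁ q' ≤ 1 + τ := by rw [dist_comm]; linarith [hw₁.2.2]
    have hR₂ : dist w₂ q' ≤ 1 + τ := by rw [dist_comm]; linarith [hw₂.2.2]
    have : dist w₁ w₂ ≤ τ / 4 + τ / 4 :=
      calc dist w₁ w₂ = dist (w₁ - q') (w₂ - q') := (dist_sub_right w₁ w₂ q').symm
        _ ≤ dist (w₁ - q') (ψ w₁ - p) + dist (ψ w₁ - p) (w₂ - q') := dist_triangle _ _ _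
        _ ≤ τ / 4 + τ / 4 := add_le_add (hψd w₁ hw₁.1 hR₁) (by rw [hEq, dist_comm]; exact hψd w₂ hw₂.1 hR₂)
    linarith

/-- **The sticky-sphere rung.**  A hard-core-1, relatively dense (covering radius < 9/10), two-way uniformly recurrent point set whose
ℕ-truncated `τ/2`-contact deficit `12 − #Kiss` has ZERO cube density has NO `τ`-contact-deficient site: every site has at least twelve
`τ`-contacts.  (Recurrence dividend for contact counts × grid lower bound × the zero-mean law; integer charges leave no slack.) [this file] -/
theorem stickyZeroSlackRung {Y : Set (EuclideanSpace ℝ (Fin 3))} {τ : ℝ} (hτ : 0 < τ) (hτ1 : τ ≤ 1)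
    (hcore : ∀ p ∈ Y, ∀ q ∈ Y, p ≠ q → 1 ≤ dist p q)
    (hcov : ∀ z : EuclideanSpace ℝ (Fin 3), ∃ w ∈ Y, dist z w < 9 / 10)
    (hrec : (∀ R ε : ℝ, 0 < ε → ∃ L : ℝ, ∀ p ∈ Y, ∀ q ∈ Y, ∃ q' ∈ Y, dist q' q ≤ L ∧ (∀ y ∈ Y, dist y p ≤ R → ∃ y' ∈ Y, dist (y' - q') (y - p) ≤ ε) ∧ (∀ y' ∈ Y, dist y' q' ≤ R → ∃ y ∈ Y, dist (y' - q') (y - p) ≤ ε)))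
    (hlaw : ∀ κ : ℝ, 0 < κ → ∃ ℓ₀ : ℝ, ∀ ℓ : ℝ, ℓ₀ ≤ ℓ → ∀ (c : EuclideanSpace ℝ (Fin 3)) (F : Finset (EuclideanSpace ℝ (Fin 3))),
      (↑F : Set (EuclideanSpace ℝ (Fin 3))) = Y ∩ {z | ∀ i : Fin 3, c i ≤ z i ∧ z i < c i + ℓ} →
      ∑ y ∈ F, ((12 - (Kiss (τ / 2) Y y).ncard : ℕ) : ℝ) ≤ κ * ℓ ^ 3) :
    ∀ y ∈ Y, 12 ≤ (Kiss τ Y y).ncard := by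
  classical
  have hUD : UniformlyDiscrete Y := ⟨1, one_pos, hcore⟩
  by_contra hcon
  push Not at hcon
  obtain ⟨y₀, hy₀, hlt⟩ := hcon
  obtain ⟨L, hL⟩ := hrec (1 + τ) (τ / 4) (by positivity)
  have hdef : ∀ q ∈ Y, ∃ q' ∈ Y, dist q' q ≤ L ∧ (Kiss (τ / 2) Y q').ncard ≤ 11 := by
    intro q hq
    obtain ⟨q', hq'Y, hq'q, -, hbwd⟩ := hL y₀ hy₀ q hq
    have := kiss_transfer hτ hτ1 hcore hy₀ hq'Y hbwd
    exact ⟨q', hq'Y, hq'q, by omega⟩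
  set L' : ℝ := max L 0 with hL'
  set s : ℝ := 2 * L' + 2 with hs
  have hL'0 : 0 ≤ L' := le_max_right L 0
  have hs0 : 0 < s := by rw [hs]; linarith
  have hg : ∀ y ∈ Y, (0 : ℝ) ≤ (fun y => ((12 - (Kiss (τ / 2) Y y).ncard : ℕ) : ℝ)) y :=
    fun y _ => Nat.cast_nonneg _
  have hheavy : ∀ z : EuclideanSpace ℝ (Fin 3), ∃ q ∈ Y, dist q z < s / 2 ∧
      (1 : ℝ) ≤ (fun y => ((12 - (Kiss (τ / 2) Y y).ncard : ℕ) : ℝ)) q := by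
    intro z
    obtain ⟨w, hw, hzw⟩ := hcov z
    obtain ⟨q', hq', hq'w, hdq⟩ := hdef w hw
    refine ⟨q', hq', ?_, ?_⟩
    · calc dist q' z ≤ dist q' w + dist w z := dist_triangle _ _ _
        _ < s / 2 := by rw [dist_comm w z, hs]; linarith [le_max_left L 0]
    · have h12 : 1 ≤ 12 - (Kiss (τ / 2) Y q').ncard := by omega
      show (1 : ℝ) ≤ ((12 - (Kiss (τ / 2) Y q').ncard : ℕ) : ℝ)
      exact_mod_cast h12
  obtain ⟨ℓ₀, hℓ₀⟩ := hlaw (1 / (2 * s ^ 3)) (by positivity)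
  obtain ⟨n, hn1, hnℓ⟩ : ∃ n : ℕ, 1 ≤ n ∧ ℓ₀ ≤ (n : ℝ) * s := by
    obtain ⟨m, hm⟩ := exists_nat_ge (ℓ₀ / s)
    refine ⟨m + 1, by omega, ?_⟩
    have hm' : ℓ₀ / s ≤ ((m + 1 : ℕ) : ℝ) := by push_cast; linarith
    have : ℓ₀ / s * s ≤ ((m + 1 : ℕ) : ℝ) * s := mul_le_mul_of_nonneg_right hm' hs0.le
    rwa [div_mul_cancel₀ ℓ₀ hs0.ne'] at this
  have hℓ : (0 : ℝ) ≤ (n : ℝ) * s := by positivity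
  set F : Finset (EuclideanSpace ℝ (Fin 3)) := (finite_inter_cube hUD (0 : EuclideanSpace ℝ (Fin 3)) hℓ).toFinset with hFdef
  have hF : (↑F : Set (EuclideanSpace ℝ (Fin 3))) =
      Y ∩ {z | ∀ i : Fin 3, (0 : EuclideanSpace ℝ (Fin 3)) i ≤ z i ∧ z i < (0 : EuclideanSpace ℝ (Fin 3)) i + n * s} := by
    rw [hFdef, Set.Finite.coe_toFinset]
  have h1 : (n : ℝ) ^ 3 * 1 ≤ ∑ y ∈ F, (fun y => ((12 - (Kiss (τ / 2) Y y).ncard : ℕ) : ℝ)) y :=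
    grid_lower_bound _ hg hs0 hheavy n 0 F hF
  have h2 : ∑ y ∈ F, ((12 - (Kiss (τ / 2) Y y).ncard : ℕ) : ℝ) ≤ 1 / (2 * s ^ 3) * ((n : ℝ) * s) ^ 3 :=
    hℓ₀ ((n : ℝ) * s) hnℓ 0 F hF
  have h3 : 1 / (2 * s ^ 3) * ((n : ℝ) * s) ^ 3 = (n : ℝ) ^ 3 / 2 := by
    field_simp
  have hn : (1 : ℝ) ≤ n := by exact_mod_cast hn1
  have h4 : (n : ℝ) ^ 3 ≤ (n : ℝ) ^ 3 / 2 := by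
    have h1' : (n : ℝ) ^ 3 ≤ ∑ y ∈ F, ((12 - (Kiss (τ / 2) Y y).ncard : ℕ) : ℝ) := by simpa using h1
    linarith [h1', h2, h3.le, h3.ge]
  nlinarith [pow_pos (show (0 : ℝ) < n by linarith) 3]

end Summit.AtomisticToContinuum.Crystallization.Theorems.OverbindingBudgetViolatorDensityFloor
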